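import Mathlib.Algebra.Group.Subgroup.Basic
import Mathlib.GroupTheory.Subgroup.Centralizer
import Mathlib.Tactic
import HarnessLib

/-!
# Crux `GordTwoRankOne` (item 19358): record KIT for the rank-one two-witness visibility door — independence of two
# points modulo `3·E'(ℚ)` from FOUR non-divisibility facts

Cell `bsd-addord`, seat `bsd-addord-k1-c3` (D-0074 row B2), gen 7; support for the per-pair kernel records of
`AdditiveBranchIMCGordTwoRankOneVisibility[Cert].lean`. HONEST FRAMING: pure group theory; books nothing.

The door `missingLowerBoundAt_rankOne_irr_of_twoWitnesses_locallyDivisible` asks for the independence of the two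
witnesses modulo `p·E'(ℚ)` in the form `∀ a b : ℤ, a•T₁ + b•T₂ ∈ pE'(ℚ) → p ∣ a ∧ p ∣ b`. For `p = 3` this is
equivalent to FOUR single-point statements `T ∉ 3E'(ℚ)` for `T ∈ {T₁, T₂, T₁ + T₂, T₁ − T₂}` (the non-zero
vectors of `𝔽₃²` up to sign), each of which the tree decides by a reduction certificate
(`not_mem_range_zsmul_of_reductionCert`). This file proves that equivalence direction (`indep_mod_three_of_not_mem`),
for any additive commutative group. [folklore]
-/

set_option autoImplicit false

set_option linter.dupNamespace false

namespace Summit.BirchSwinnertonDyer.BirchSwinnertonDyer.Theorems.AdditiveBranchIMCGordTwoRankOneVisibility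

universe u

variable {A : Type u} [AddCommGroup A]

/-- Membership in the range of multiplication by `((3 : ℕ) : ℤ)` is `∃ w, 3 • w = z`. [folklore] -/
theorem mem_range_zsmul_three_iff (z : A) :
    z ∈ (zsmulAddGroupHom ((3 : ℕ) : ℤ) : A →+ A).range ↔ ∃ w : A, (3 : ℤ) • w = z := by
  simp [AddMonoidHom.mem_range]

/-- **Independence modulo `3A` from four non-divisibilities.** In an additive commutative group `A`, if none of
`x`, `y`, `x + y`, `x − y` lies in `3A`, then `a•x + b•y ∈ 3A` forces `3 ∣ a` and `3 ∣ b` (reduce `a`, `b` mod `3`;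
the nine residue pairs are `(0,0)` or one of the four points up to sign). Stated in the `((3 : ℕ) : ℤ)`-cast form of
the visibility door's binder `hind`. [folklore] -/
theorem indep_mod_three_of_not_mem {x y : A}
    (hx : x ∉ (zsmulAddGroupHom ((3 : ℕ) : ℤ) : A →+ A).range)
    (hy : y ∉ (zsmulAddGroupHom ((3 : ℕ) : ℤ) : A →+ A).range)
    (hs : x + y ∉ (zsmulAddGroupHom ((3 : ℕ) : ℤ) : A →+ A).range)
    (hd : x - y ∉ (zsmulAddGroupHom ((3 : ℕ) : ℤ) : A →+ A).range) :
    ∀ a b : ℤ, a • x + b • y ∈ (zsmulAddGroupHom ((3 : ℕ) : ℤ) : A →+ A).range →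
      ((3 : ℕ) : ℤ) ∣ a ∧ ((3 : ℕ) : ℤ) ∣ b := by
  intro a b hab
  rw [mem_range_zsmul_three_iff] at hab hx hy hs hd
  obtain ⟨w, hw⟩ := hab
  -- the residual combination is a multiple of 3
  have key : (a % 3) • x + (b % 3) • y = (3 : ℤ) • (w - (a / 3) • x - (b / 3) • y) := by
    have e1 : a % 3 = a - 3 * (a / 3) := by omega
    have e2 : b % 3 = b - 3 * (b / 3) := by omega
    rw [zsmul_sub, zsmul_sub, hw, smul_smul, smul_smul, e1, e2, sub_zsmul, sub_zsmul]
    abel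
  -- residues in {0, 1, 2}
  obtain ⟨r, hr⟩ : ∃ r : ℤ, r = a % 3 := ⟨_, rfl⟩
  obtain ⟨s, hs'⟩ : ∃ s : ℤ, s = b % 3 := ⟨_, rfl⟩
  have hr0 : 0 ≤ r := hr ▸ Int.emod_nonneg a (by norm_num)
  have hr3 : r < 3 := hr ▸ Int.emod_lt_of_pos a (by norm_num)
  have hs0 : 0 ≤ s := hs' ▸ Int.emod_nonneg b (by norm_num)
  have hs3 : s < 3 := hs' ▸ Int.emod_lt_of_pos b (by norm_num)
  rw [← hr, ← hs'] at key
  set u : A := w - (a / 3) • x - (b / 3) • y with hu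
  have cast3 : ((3 : ℕ) : ℤ) = 3 := by norm_num
  rw [cast3]
  -- nine cases
  interval_cases r <;> interval_cases s
  · exact ⟨Int.dvd_of_emod_eq_zero hr.symm, Int.dvd_of_emod_eq_zero hs'.symm⟩
  · -- (0,1): y = 3u
    exact absurd ⟨u, by rw [← key, zero_zsmul, zero_add, one_zsmul]⟩ hy
  · -- (0,2): 2y = 3u ⇒ y = 3y - 2y = 3(y - u)
    exact absurd ⟨y - u, by rw [zsmul_sub, ← key, zero_zsmul, zero_add]; abel⟩ hy
  · -- (1,0): x = 3u
    exact absurd ⟨u, by rw [← key, one_zsmul, zero_zsmul, add_zero]⟩ hx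
  · -- (1,1): x + y = 3u
    exact absurd ⟨u, by rw [← key, one_zsmul, one_zsmul]⟩ hs
  · -- (1,2): x + 2y = 3u ⇒ x - y = 3u - 3y
    exact absurd ⟨u - y, by rw [zsmul_sub, ← key, one_zsmul]; abel⟩ hd
  · -- (2,0): 2x = 3u ⇒ x = 3x - 2x
    exact absurd ⟨x - u, by rw [zsmul_sub, ← key, zero_zsmul, add_zero]; abel⟩ hx
  · -- (2,1): 2x + y = 3u ⇒ x - y = 3x - 3u
    exact absurd ⟨x - u, by rw [zsmul_sub, ← key, one_zsmul]; abel⟩ hd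
  · -- (2,2): 2(x+y) = 3u ⇒ x + y = 3(x+y) - 2(x+y)
    exact absurd ⟨x + y - u, by rw [zsmul_sub, ← key]; abel⟩ hs

end Summit.BirchSwinnertonDyer.BirchSwinnertonDyer.Theorems.AdditiveBranchIMCGordTwoRankOneVisibility
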